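import Literature.Combinatorics.SimpleGraph.FormulaGadgets
import HarnessLib

/-!
# The graph of a formula, II: the number of Hamiltonian paths is `#SAT`

The count of the `#SAT → #HamPath` construction of `FormulaGadgets.lean`. For a CNF `φ` over `ℕ`
all of whose clauses have one, two or three literals, and with at least one literal, the graph
`FormulaGraph.graph φ` (the diamond chain on the cells with all the gadgets of `FormulaGraph.family`
substituted) has exactly `#SAT(φ)` Hamiltonian paths from `s = 0` to `t = 5N - 1`
(`FormulaGraph.hamCount_graph_eq_numSat`). Proof: the iterated substitution identity
(`GadgetFamily.Valid.hamCountRF_graphUpTo`) writes the count as a census-weighted sum over the used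
slots; the skeleton count (`hamCountRF_chain_eq_card`) turns it into a sum over state vectors; by the
certified censuses every gadget contributes a factor `0` or `1` — the XOR-gadgets the indicator of
"equal states at consecutive occurrences", the OR-gadgets the indicator of "some literal of the
clause true" — so the sum counts the good state vectors, which are `#SAT(φ)` many
(`FormulaCells.card_good_eq_numSat`). The reduction is parsimonious (no correcting factor).

## References

* M. Liśkiewicz, M. Ogihara, S. Toda, TCS 304 (2003) 129–156, §3 (proof of Lemma 4).
-/

namespace Literature.Combinatorics.SimpleGraph

open Literature.Computability.Complexity FormulaCells

namespace FormulaGraph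

variable (φ : CNF ℕ)

/-- **The graph of the formula**: the diamond chain on the cells with all gadgets substituted.
[folklore] -/
noncomputable def graph : _root_.SimpleGraph ℕ :=
  GadgetFamily.graphUpTo (chainG (N φ)) (chainV (N φ)) (family φ) (numGadgets φ)

/-- The vertices of the graph of the formula. [folklore] -/
noncomputable def verts : Finset ℕ :=
  GadgetFamily.vertsUpTo (chainV (N φ)) (family φ) (numGadgets φ)

/-- All slots. [folklore] -/
noncomputable def slots : Finset (ℕ × ℕ) :=
  GadgetFamily.slotsBelow (family φ) (numGadgets φ)

/-- The slots used by the path of a state vector. [folklore] -/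
noncomputable def usedSlots (σ : Fin (N φ) → Bool) : Finset (ℕ × ℕ) :=
  (slots φ).filter fun e => Uses (pathOf (N φ) (extB σ)) e

/-! ### Step 1–4: from Hamiltonian paths to a sum over state vectors -/

/-- The constraint "use exactly the slots of `U`" singles out the state vectors whose used slots are
`U`. [folklore] -/
theorem uses_iff_eq_usedSlots {U : Finset (ℕ × ℕ)} (hU : U ⊆ slots φ) (σ : Fin (N φ) → Bool) :
    ((∀ e ∈ ∅ ∪ U, Uses (pathOf (N φ) (extB σ)) e) ∧ ∀ e ∈ ∅ ∪ (slots φ \ U), ¬ Uses (pathOf (N φ) (extB σ)) e) ↔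
      U = usedSlots φ σ := by
  simp only [Finset.empty_union, Finset.mem_sdiff]
  constructor
  · rintro ⟨h1, h2⟩
    ext e
    simp only [usedSlots, Finset.mem_filter]
    constructor
    · exact fun he => ⟨hU he, h1 e he⟩
    · rintro ⟨he, hu⟩
      by_contra hne
      exact h2 e ⟨he, hne⟩ hu
  · rintro rfl
    exact ⟨fun e he => (Finset.mem_filter.1 he).2, fun e ⟨he, hne⟩ hu => hne (Finset.mem_filter.2 ⟨he, hu⟩)⟩

/-- **The number of Hamiltonian paths as a sum over state vectors of products of censuses.**
[folklore] -/
theorem hamCount_eq_sum_states (hN : 0 < N φ) :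
    hamCount (graph φ) (verts φ) 0 (5 * N φ - 1) =
      ∑ σ : Fin (N φ) → Bool, ∏ g ∈ Finset.range (numGadgets φ),
        coverCount ((family φ).GX g) ((family φ).VX g) (usedSlots φ σ ∩ (family φ).S g) := by
  have hs : (0 : ℕ) ∈ chainV (N φ) := by simp [chainV]; omega
  have ht : 5 * N φ - 1 ∈ chainV (N φ) := by simp [chainV]; omega
  rw [hamCount, graph, verts, (valid φ (numGadgets φ)).hamCountRF_graphUpTo hs ht (numGadgets φ) le_rfl ∅ ∅ (by simp)
    (by simp)]
  -- the skeleton counts are numbers of state vectors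
  have hsk : ∀ U ∈ (slots φ).powerset,
      hamCountRF (chainG (N φ)) (chainV (N φ)) 0 (5 * N φ - 1) (∅ ∪ U) (∅ ∪ (slots φ \ U)) =
        ∑ σ : Fin (N φ) → Bool, if U = usedSlots φ σ then 1 else 0 := by
    intro U hU
    rw [Finset.mem_powerset] at hU
    rw [hamCountRF_chain_eq_card hN, Finset.card_eq_sum_ones, Finset.sum_filter]
    refine Finset.sum_congr rfl fun σ _ => ?_
    simp only [uses_iff_eq_usedSlots φ hU σ]
  rw [show GadgetFamily.slotsBelow (family φ) (numGadgets φ) = slots φ from rfl]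
  rw [Finset.sum_congr rfl fun U hU => by rw [hsk U hU, Finset.mul_sum]]
  rw [Finset.sum_comm]
  refine Finset.sum_congr rfl fun σ _ => ?_
  simp only [mul_ite, mul_one, mul_zero]
  rw [Finset.sum_ite_eq']
  rw [if_pos]
  exact Finset.mem_powerset.2 (Finset.filter_subset _ _)

/-! ### Step 5: every gadget contributes a factor `0` or `1` -/

/-- Two indicators of equivalent conditions (whatever the decidability instances). [folklore] -/
theorem ite_congr_of_iff {p q : Prop} {_ : Decidable p} {_ : Decidable q} (h : p ↔ q) :
    (if p then 1 else 0 : ℕ) = if q then 1 else 0 := by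
  by_cases hp : p
  · rw [if_pos hp, if_pos (h.1 hp)]
  · rw [if_neg hp, if_neg (fun hq => hp (h.2 hq))]

/-- The literal slot of a cell is used iff the state of the cell is the polarity of its literal.
[folklore] -/
theorem uses_litSlot_iff {τ : ℕ → Bool} {c : ℕ} (hc : c < N φ) :
    Uses (pathOf (N φ) τ) (litSlot φ c) ↔ τ c = polOf φ c := by
  unfold litSlot
  cases hp : polOf φ c
  · simp only [Bool.false_eq_true, ↓reduceIte, aq]
    exact uses_pathOf_aq hc
  · simp only [↓reduceIte, bq]
    exact uses_pathOf_bq hc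

/-- The slots of gadget `g` are slots. [folklore] -/
theorem S_subset_slots {g : ℕ} (hg : g < numGadgets φ) : (family φ).S g ⊆ slots φ := by
  intro e he
  exact GadgetFamily.mem_slotsBelow_iff.2 ⟨g, hg, he⟩

/-- The used slots among the slots of a placed gadget are the images of the rails whose slot edge is
used. [folklore] -/
theorem usedSlots_inter_eq (σ : Fin (N φ) → Bool) (P : RailPlacement) (hP : P.S ⊆ slots φ) :
    usedSlots φ σ ∩ P.S = (Finset.univ.filter fun r => Uses (pathOf (N φ) (extB σ)) (P.ends r)).image P.ends := by
  ext e
  simp only [usedSlots, Finset.mem_inter, Finset.mem_filter, Finset.mem_image, Finset.mem_univ, true_and]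
  constructor
  · rintro ⟨⟨-, hu⟩, he⟩
    obtain ⟨r, rfl⟩ := P.mem_S_iff.1 he
    exact ⟨r, hu, rfl⟩
  · rintro ⟨r, hu, rfl⟩
    have hmem : P.ends r ∈ P.S := P.mem_S_iff.2 ⟨r, rfl⟩
    exact ⟨⟨hP hmem, hu⟩, hmem⟩

/-- **What gadget `g` checks on a state vector**: equal states at cell `g` and the next occurrence of
its variable (XOR-gadgets), a true literal in clause `j` if `g = N + j` (OR-gadgets). [folklore] -/
def GadgetOK (σ : Fin (N φ) → Bool) (g : ℕ) : Prop :=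
  (∀ c', next? φ g = some c' → extB σ g = extB σ c') ∧
    ∀ j, ∀ hj : j < φ.length, g = N φ + j → ∃ r, ∃ _ : r < φ[j].length, extB σ (start φ j + r) = polOf φ (start φ j + r)

/-- The census factor of an XOR placement. [folklore] -/
theorem census_xor (σ : Fin (N φ) → Bool) (g : ℕ) (hg : g < N φ) (c' : {c' : ℕ // g < c' ∧ c' < N φ})
    (hS : (xorPlacement φ g c').S ⊆ slots φ) :
    coverCount (xorPlacement φ g c').GX (xorPlacement φ g c').VX (usedSlots φ σ ∩ (xorPlacement φ g c').S) =
      if extB σ g = extB σ c'.val then 1 else 0 := by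
  set P := xorPlacement φ g c' with hPdef
  rw [usedSlots_inter_eq φ σ P hS, P.coverCount_image]
  rw [show P.Γ = RailXOR.Γ from rfl]
  generalize hU₀ : (Finset.univ.filter fun r => Uses (pathOf (N φ) (extB σ)) (P.ends r)) = U₀
  have hsub : U₀.image RailXOR.Γ.slot ⊆ RailXOR.Γ.slots := fun e he => by
    obtain ⟨r, -, rfl⟩ := Finset.mem_image.1 he
    exact RailXOR.Γ.mem_slots_iff.2 ⟨r, rfl⟩
  rw [RailXOR.coverCount_eq _ hsub, Finset.card_image_of_injective _ RailXOR.Γ.slot_injective, ← hU₀]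
  -- which of the two rails has its slot edge used
  have h0 : Uses (pathOf (N φ) (extB σ)) (P.ends 0) ↔ extB σ g = true := by
    show Uses (pathOf (N φ) (extB σ)) (if (0 : Fin 2) = 0 then pa g else pb c'.val) ↔ _
    rw [if_pos rfl]; exact uses_pathOf_pa hg
  have h1 : Uses (pathOf (N φ) (extB σ)) (P.ends 1) ↔ extB σ c'.val = false := by
    show Uses (pathOf (N φ) (extB σ)) (if (1 : Fin 2) = 0 then pa g else pb c'.val) ↔ _
    rw [if_neg (by decide)]; exact uses_pathOf_pb c'.property.2
  have hfilt : (Finset.univ.filter fun r => Uses (pathOf (N φ) (extB σ)) (P.ends r)) =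
      (if extB σ g = true then {0} else ∅) ∪ (if extB σ c'.val = false then {1} else ∅) := by
    ext r
    have : ∀ s : Fin 2, s = 0 ∨ s = 1 := by decide
    simp only [Finset.mem_filter, Finset.mem_univ, true_and, Finset.mem_union]
    rcases this r with rfl | rfl
    · rw [h0]; split_ifs <;> simp_all
    · rw [h1]; split_ifs <;> simp_all
  rw [hfilt]
  cases extB σ g <;> cases extB σ c'.val <;> simp

open Classical in
/-- The census factor of a clause placement. [folklore] -/
theorem census_clause (σ : Fin (N φ) → Bool) {k K m : ℕ} (Γ : RailGadget k K m)
    (hcensus : ∀ U ⊆ Γ.slots, coverCount Γ.graph Γ.VX U = if U = ∅ then 0 else 1)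
    (j : ℕ) (hj : j < φ.length) (hk : k ≤ φ[j].length) (hk' : φ[j].length = k) (g : ℕ)
    (hS : (clausePlacement φ Γ j hj hk g).S ⊆ slots φ) :
    coverCount (clausePlacement φ Γ j hj hk g).GX (clausePlacement φ Γ j hj hk g).VX
        (usedSlots φ σ ∩ (clausePlacement φ Γ j hj hk g).S) =
      if ∃ r, ∃ _ : r < φ[j].length, extB σ (start φ j + r) = polOf φ (start φ j + r) then 1 else 0 := by
  set P := clausePlacement φ Γ j hj hk g with hPdef
  have hends : ∀ r : Fin k, Uses (pathOf (N φ) (extB σ)) (P.ends r) ↔ extB σ (start φ j + r.val) = polOf φ (start φ j + r.val) :=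
    fun r => by have hrk : r.val < k := r.isLt; exact uses_litSlot_iff φ (start_add_lt φ hj (by omega))
  rw [usedSlots_inter_eq φ σ P hS, P.coverCount_image]
  rw [show P.Γ = Γ from rfl]
  generalize hU₀ : (Finset.univ.filter fun r => Uses (pathOf (N φ) (extB σ)) (P.ends r)) = U₀
  have hsub : U₀.image Γ.slot ⊆ Γ.slots := fun e he => by
    obtain ⟨r, -, rfl⟩ := Finset.mem_image.1 he
    exact Γ.mem_slots_iff.2 ⟨r, rfl⟩
  have key : (U₀.image Γ.slot = ∅) ↔ ¬ ∃ r, ∃ _ : r < φ[j].length, extB σ (start φ j + r) = polOf φ (start φ j + r) := by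
    rw [Finset.image_eq_empty, ← hU₀]
    constructor
    · rintro h ⟨r, hr, heq⟩
      have := Finset.eq_empty_iff_forall_notMem.1 h ⟨r, (by omega : r < k)⟩
      apply this
      rw [Finset.mem_filter]
      exact ⟨Finset.mem_univ _, (hends ⟨r, by omega⟩).2 heq⟩
    · intro h
      refine Finset.eq_empty_iff_forall_notMem.2 fun r hr => ?_
      rw [Finset.mem_filter] at hr
      have hrk : r.val < k := r.isLt
      exact h ⟨r.val, by omega, (hends r).1 hr.2⟩
  rw [hcensus _ hsub]
  by_cases hex : ∃ r, ∃ _ : r < φ[j].length, extB σ (start φ j + r) = polOf φ (start φ j + r)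
  · rw [if_pos hex, if_neg (fun h => (key.1 h) hex)]
  · rw [if_neg hex, if_pos (key.2 hex)]

/-- There is no next occurrence after a non-cell. [folklore] -/
theorem next?_eq_none_of_le {g : ℕ} (hg : N φ ≤ g) : next? φ g = none := by
  unfold next?
  rw [dif_neg]
  rintro ⟨c', h1, h2, -⟩
  omega

/-- `N(∅) = 1` for the empty gadget. [folklore] -/
theorem coverCount_bot_empty : coverCount (⊥ : _root_.SimpleGraph ℕ) ∅ ∅ = 1 := by
  rw [coverCount]
  have : coverSet (⊥ : _root_.SimpleGraph ℕ) ∅ ∅ = {fun _ => []} := by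
    ext f
    simp only [coverSet, Set.mem_setOf_eq, Set.mem_singleton_iff, IsCover]
    constructor
    · rintro ⟨-, hf, -, -⟩; funext e; exact hf e (Finset.notMem_empty e)
    · rintro rfl
      exact ⟨fun e he => absurd he (Finset.notMem_empty e), fun e _ => rfl,
        fun e he => absurd he (Finset.notMem_empty e), fun x hx => absurd hx (Finset.notMem_empty x)⟩
  rw [this, Set.ncard_singleton]

open Classical in
/-- **Every gadget contributes the indicator of what it checks.** [folklore] -/
theorem census_gadget (hw : ∀ C ∈ φ, C.length = 1 ∨ C.length = 2 ∨ C.length = 3) (σ : Fin (N φ) → Bool) {g : ℕ}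
    (hg : g < numGadgets φ) :
    coverCount ((family φ).GX g) ((family φ).VX g) (usedSlots φ σ ∩ (family φ).S g) = if GadgetOK φ σ g then 1 else 0 := by
  have hS := S_subset_slots φ hg
  rw [family_S] at hS ⊢
  rw [family_GX, family_VX]
  by_cases hgN : g < N φ
  · -- a cell: XOR-gadget or nothing
    rw [place_cell_eq φ hgN] at hS ⊢
    have hval := nextSub_val φ g
    cases hn : nextSub φ g with
    | none =>
      rw [hn] at hval
      simp only [Option.map_none] at hval
      simp only [Option.map_none, Option.elim_none, Finset.inter_empty]
      rw [coverCount_bot_empty, if_pos]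
      exact ⟨fun c' hc' => by rw [← hval] at hc'; simp at hc', fun j hj hgj => by omega⟩
    | some c' =>
      rw [hn] at hval hS
      simp only [Option.map_some, Option.elim_some] at hval hS ⊢
      rw [census_xor φ σ g hgN c' hS]
      refine ite_congr_of_iff ⟨fun heq => ⟨fun c'' hc'' => ?_, fun j hj hgj => by omega⟩, fun hok => hok.1 c'.val hval.symm⟩
      rw [← hval] at hc''
      simp only [Option.some.injEq] at hc''
      rw [← hc'']; exact heq
  · -- a clause: OR-gadget
    obtain ⟨j, rfl⟩ : ∃ j, g = N φ + j := ⟨g - N φ, by omega⟩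
    have hj : j < φ.length := by unfold numGadgets at hg; omega
    have hiff : GadgetOK φ σ (N φ + j) ↔ ∃ r, ∃ _ : r < φ[j].length, extB σ (start φ j + r) = polOf φ (start φ j + r) := by
      constructor
      · exact fun hok => hok.2 j hj rfl
      · intro hex
        refine ⟨fun c' hc' => ?_, fun j' hj' hjj' => ?_⟩
        · rw [next?_eq_none_of_le φ (by omega)] at hc'; simp at hc'
        · have : j' = j := by omega
          subst this; exact hex
    rw [place_clause_eq φ j hj] at hS ⊢
    rcases hw _ (List.getElem_mem hj) with h1 | h2 | h3
    · rw [dif_pos h1] at hS ⊢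
      simp only [Option.elim_some] at hS ⊢
      rw [census_clause φ σ RailOR1.Γ RailOR1.coverCount_eq j hj (by omega) h1 _ hS]
      exact ite_congr_of_iff hiff.symm
    · rw [dif_neg (by omega), dif_pos h2] at hS ⊢
      simp only [Option.elim_some] at hS ⊢
      rw [census_clause φ σ RailOR2.Γ RailOR2.coverCount_eq j hj (by omega) h2 _ hS]
      exact ite_congr_of_iff hiff.symm
    · rw [dif_neg (by omega), dif_neg (by omega), dif_pos h3] at hS ⊢
      simp only [Option.elim_some] at hS ⊢
      rw [census_clause φ σ RailOR3.Γ RailOR3.coverCount_eq j hj (by omega) h3 _ hS]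
      exact ite_congr_of_iff hiff.symm

/-! ### Step 6: the good state vectors -/

/-- States of cells, extended or not. [folklore] -/
theorem extB_val {N' : ℕ} (σ : Fin N' → Bool) (c : Fin N') : extB σ c.val = σ c := by
  simp [extB]

/-- **All gadgets check out iff the state vector is good.** [folklore] -/
theorem forall_gadgetOK_iff_good (σ : Fin (N φ) → Bool) : (∀ g < numGadgets φ, GadgetOK φ σ g) ↔ Good φ σ := by
  rw [good_iff, uniform_iff_forall_next]
  constructor
  · intro h
    refine ⟨fun c c' hn => ?_, fun j hj => ?_⟩
    · have := (h c.val (by unfold numGadgets; omega)).1 c'.val hn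
      rwa [extB_val, extB_val] at this
    · obtain ⟨r, hr, heq⟩ := (h (N φ + j) (by unfold numGadgets; omega)).2 j hj rfl
      refine ⟨r, hr, ?_⟩
      rw [← heq, extB, dif_pos (start_add_lt φ hj hr)]
  · rintro ⟨hnext, hcl⟩ g hg
    refine ⟨fun c' hn => ?_, fun j hj hgj => ?_⟩
    · obtain ⟨h1, h2, -⟩ := next?_spec φ hn
      have hgN : g < N φ := by omega
      have := hnext ⟨g, hgN⟩ ⟨c', h2⟩ hn
      rwa [← extB_val σ ⟨g, hgN⟩, ← extB_val σ ⟨c', h2⟩] at this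
    · subst hgj
      obtain ⟨r, hr, heq⟩ := hcl j hj
      exact ⟨r, hr, by rw [← heq, extB, dif_pos (start_add_lt φ hj hr)]⟩

open Classical in
/-- **The graph of a formula has exactly `#SAT(φ)` Hamiltonian `s`–`t` paths** (clauses of one, two
or three literals, at least one literal). [cite: LiskiewiczOgiharaToda2003, §3 (proof of Lemma 4)] -/
theorem hamCount_graph_eq_numSat (hw : ∀ C ∈ φ, C.length = 1 ∨ C.length = 2 ∨ C.length = 3) (hN : 0 < N φ) :
    hamCount (graph φ) (verts φ) 0 (5 * N φ - 1) = φ.numSat := by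
  rw [hamCount_eq_sum_states φ hN]
  rw [Finset.sum_congr rfl fun σ _ => Finset.prod_congr rfl fun g hg => census_gadget φ hw σ (Finset.mem_range.1 hg)]
  simp only [Finset.prod_boole, Finset.mem_range]
  rw [Finset.sum_boole, Nat.cast_id, ← card_good_eq_numSat]
  congr 1
  ext σ
  simp only [Finset.mem_filter, Finset.mem_univ, true_and]
  exact forall_gadgetOK_iff_good φ σ

end FormulaGraph

end Literature.Combinatorics.SimpleGraph
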